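import Mathlib
import HarnessLib
import HarnessLib.Audit
import Summits.HubbardSuperconductivity.Statement
import Literature.MathematicalPhysics.QuantumLattice.NagaokaTasaki
import Literature.MathematicalPhysics.QuantumLattice.PairCorrelationsProofs
import HarnessLib.Audit.Status.Attr

/-!
Route: ProjectedBCSGas

DORMANT since 2026-08-22T22:31:04Z (reconciler: no traction for 5.7 d (last activity item-evidence-added at 2026-08-17T04:40:47Z); parked, not closed — `ledger route dormant route-HubbardSuperconductivity-ProjectedBCSGas --off` to react) — unstaffed, not closed; items shared with open routes are served there. `ledger route dormant <id> --off` reactivates.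

Route ProjectedBCSGas — "Anderson's wavefunction as a theorem" (idea card
projected-bcs-determinantal-gas). CONDITIONAL BRIDGE.

It suffices to show X := RVBShadowing ∧ ProjectedBCSPairLRO, where, for the explicit trial family
  χ[g,Δv,μ,δ]_L := normalise( P_g · P_{N_L} · Π_{k∈(2π/L)ℤ_L²} (u_k + v_k c†_{k↑}c†_{-k↓}) |0⟩ ) ∈
Fock((ℤ/Lℤ)²),
  u_k² = (1+ξ_k/E_k)/2, v_k = sgn(Δ_k)·√((1-ξ_k/E_k)/2), ξ_k = -2(cos k₁+cos k₂) - μ, Δ_k = Δv(cos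
k₁ - cos k₂), E_k = √(ξ_k²+Δ_k²),
  P_{N_L} = projection on N_L = 2⌊(1-δ)L²/2⌋ particles (so S^z = 0), P_g = g^{#doubly occupied
sites} (g = 0: full Gutzwiller projection = Anderson/PRT RVB state; g = 1: number-projected d-wave
BCS; 0<g<1: Laughlin's gossamer family),
(1) ProjectedBCSPairLRO (crux, rank 2 — the prize, unconditional): for EVERY g ∈ [0,1], Δv ∈ (0,4],
μ ∈ [-4,4], δ ∈ (0,1/2) there are a > 0, R, L₀ with pairFieldCorr_d(χ)_L(x,y) ≥ a for all even L ≥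
L₀ and all torus-distant pairs ‖x-y‖_∞ ≥ R — "every (partially) Gutzwiller-projected d-wave BCS
state superconducts": a clustering theorem for the positive measure |χ|², a two-species
determinantal/Pfaffian gas tilted by the doublon weight g^{2D};
(2) RVBShadowing (crux, rank 3 — the CONDITION, no technology today): ∃ U > 0, δ ∈ (0,1/2), (g,Δv,μ)
in the window, η ∈ [0,1) such that ∀ ε > 0 ∃ R, L₀: every normalised (N_L, S^z=0)-sector ground
state ψ_L of hubbardTorus 2 L 1 U (L even ≥ L₀) has |G_ψ(x,y) - G_χ(x,y)| ≤ η|G_χ(x,y)| + ε at all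
‖x-y‖_∞ ≥ R (G = pairFieldCorr dWaveFormFactor) — the d-wave pair correlator of the true ground
states is shadowed, up to relative error η < 1, by one member of the family (what every variational
account of cuprate superconductivity asserts).
Assembly (rank 1): RVBShadowing → ProjectedBCSPairLRO → HubbardSuperconductivity: G_ψ ≥ (1-η)a - ε =
(1-η)a/2 on all but O(R²L²) of the L⁴ pairs, |G_ψ| ≤ ‖P_x‖² elsewhere, hence liminf (2k)⁻⁴ Σ G_ψ ≥
(1-η)a/2 > 0 along even sides = the summit's HasLongRangeOrder conclusion.
Lean: all six decls are one-line Props over existing declarations (Fock, Orb, FermionTorus,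
creation, orb, vacuum, gutzwillerProj, pairFieldCorr, dWaveFormFactor, torusDist,
IsGroundStateInSector, hubbardTorus, HubbardSuperconductivity); the family χ is inlined verbatim in
each (term-level `open … in` + let-chain); Sketch.lean elaborates (lean check rc 0, 2026-08-15).

CONDITIONAL on RVBShadowing — this route is an explicit reduction to that named conjecture (D-0019: crux floor waived).

Rationale: WHY THIS LINE (transplant with an explicit dictionary; classical statistical mechanics of a positive
measure). For the FQHE the rigorous literature proved theorems about LAUGHLIN'S WAVEFUNCTION (plasma
analogy: RougerieSerfatyYngvason2013, LiebRougerieYngvason2018) long before anything about the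
Coulomb Hamiltonian. The conjectured answer to this summit also comes with an explicit wavefunction
— Anderson's RVB = the Gutzwiller-projected d-wave BCS state (Anderson1987, ZhangEtAl1988, Gros1989,
AndersonEtAl2004) — whose d-wave pair ODLRO (Φ ∝ δ, ParamekantiRanderiaTrivedi2001/2004,
EdeggerMuthukumarGros2007) is a 38-year-old NUMERICAL fact and has never been proved. Dictionary:
|Laughlin|² ↦ |P_g P_N dBCS|² (a two-species determinantal/Pfaffian gas conditioned/tilted by the
doublon weight g^{2D}, sign-free — it is what VMC samples); screening ⇒ incompressibility ↦
clustering ⇒ pair ODLRO; partial projection g ↦ Laughlin's gossamer family (arXiv:cond-mat/0209269),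
whose (1-g²)-expansion about the Wick-solvable g = 1 point is the
Metzner–Vollhardt/Gebhard–Vollhardt series (MetznerVollhardt1988, GebhardVollhardt1987; d = 2
uncontrolled: doi:10.1103/physrevb.47.4168). The route splits S into a THEOREM about χ (crux 1) and
a falsifiable physical HYPOTHESIS linking χ to the true ground states (crux 2, the declared
condition). Parameter window (g ∈ [0,1], Δv ∈ (0,4], μ ∈ [-4,4], δ ∈ (0,1/2)): a band-scale box
containing every VMC-optimal parameter set reported (Δv_opt ≲ 1.2t, μ inside the band;
ParamekantiRanderiaTrivedi2004) and the weak-coupling corner Δv → 0⁺; crux 1 is UNIVERSAL over it so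
that the assembly does not depend on which member does the shadowing, crux 2 EXISTENTIAL over the
same box.
RANKED CRUXES. (rank 2) ProjectedBCSPairLRO — every member of the family has a uniform d-wave
pair-coherence floor at large torus distance; provable corners first: g = 1 (support
UnprojectedBCSPairLRO: Wick/Pfaffian + equivalence of ensembles for number projection), g ∈ [g₀,1]
(support GossamerWindowPairLRO: convergent cluster expansion in 1-g² over the determinantal
reference process), μ → -∞ limit = doped nearest-neighbour RVB (support DopedRVBPairLRO:
Sutherland1988 loop gas + monomers, RokhsarKivelson1988); the prize is g = 0. (rank 3) RVBShadowing
— the condition; refuters should try to kill it in corners (e.g. show that no member of the family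
can shadow a weak-coupling ground state, or use QinEtAl2020-type regimes), provers leave it alone.
KILL CRITERIA. ProjectedBCSPairLRO refuted anywhere in the window (a "projection transition": pair
coherence of |χ|² lost at some g < 1, or a sign change of G_χ at large distance for infinitely many
L) breaks the route; repair = shrink the window to the LI-relevant corner or restate with the
optimal-parameter curve. RVBShadowing refuted for ALL parameters (e.g. an exact asymptotic mismatch
between sector ground states and every χ) closes the route as refuted; the stat-mech theorems filed
as supports keep their value. A proof that truncated correlations of the nodal d-wave determinantal
process are not summable kills the (1-g²)-expansion METHOD, not the statements (fallback: nodeless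
d+id regulator inside the proof).
NOT DECOMPOSED YET (D-0019). No children until a corner closes: the cluster-expansion lemmas
(uniform bounds on truncated correlations of the BCS determinantal process with
exponentially/power-law decaying kernel), the ensemble-equivalence lemma for P_N, the
loop-gas/height-function machinery for the RVB rung, exact small-torus enumerations (kit)
calibrating a(g,Δv,μ,δ) and the radius in 1-g² — all ride later as --supports or as a glued split of
ProjectedBCSPairLRO by regime (g = 1 | [g₀,1] | 0).
NOVELTY: see the Novelty field — nearest prior art MetznerVollhardt1988/GebhardVollhardt1987 (the
(g²-1) series, exact only in d = 1, ∞), Sutherland1988 + Tasaki1993 (RVB loop gas; exact RVB ground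
states with ODLRO conjectured, not proved), ParamekantiRanderiaTrivedi2001 (numerics); no theorem on
pair LRO of projected dBCS or doped NN-RVB in d = 2 was found (crossref/vsearch/frontier 2026-08-15;
searchd+galaxy down this session; card + novelty audit searches concur). Grade on the card:
new-combination.
BARRIERS: see the Barriers field — SignProblemNPHard structurally evaded (|χ|² ≥ 0);
StrongCouplingCeiling not engaged (no expansion of e^{-βH} or derivation of χ from H; the cluster
expansion is in 1-g² for a wavefunction measure); GeneralizedHartreeFockNoPairing not engaged (χ is
not quasi-free for g < 1 and no variational-energy claim is made); LROForcesLowLyingStates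
consistent (χ is number-projected, LRO without an anomalous average); PureModelStripeCompetition is
exactly RVBShadowing's why-might-fail (LI expected false at U = 8, δ = 1/8).

Novelty: Nearest prior art (searched 2026-08-15: crossref "off-diagonal long-range order resonating valence
bond doped rigorous", "Gutzwiller projected BCS wave function long-range order superconducting",
"doped short-range RVB dimer monomer superconductivity", "gossamer partially projected BCS"; lit
vsearch (held Montorsi reprint volume pp. 361-364 = Gros–Joynt–Rice VMC, numerics); lit frontier
HubbardSuperconductivity --since 2020 (arXiv:2601.18868, numerics); searchd/galaxy unavailable this
session; plus the card's and the novelty audit's searches): MetznerVollhardt1988 +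
GebhardVollhardt1987 — Gutzwiller expectation values as a power series in (g²-1), exact in d = 1 and
d = ∞ only (= our 1-g² expansion in its original, non-rigorous-in-d=2 form; d = 2 high-order series
doi:10.1103/physrevb.47.4168); Sutherland1988 (NN-RVB norms/correlators = classical loop gas) and
Tasaki1993 (exact RVB ground states of designer repulsive Hubbard models; ODLRO conjectured, not
proved; Tian doi:10.1088/0305-4470/27/20/008); ParamekantiRanderiaTrivedi2001,
ParamekantiRanderiaTrivedi2004, Gros1989, EdeggerMuthukumarGros2007 (projected d-wave BCS: Φ ∝ δ by
VMC — numerics); Ivanov doi:10.1103/physrevb.74.024525 (RVB structure of projected SC wavefunctions,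
no LRO theorem); FradkinKivelson doi:10.1142/s0217984990000295 (short-range RVB and SC, heuristics);
the Laughlin-phase template RougerieSerfatyYngvason2013, LiebRougerieYngvason2018. DELTA: no theorem
(or stated programme) on d-wave pair LRO of the G  [refs: 10.1103/physrevb.47.4168, 10.1088/0305-4470/27/20/008, 10.1103/physrevb.74.024525, 10.1142/s0217984990000295, 2601.18868, doi:10.1103/physrevb.47.4168, doi:10.1088/0305-4470/27/20/008, doi:10.1103/physrevb.74.024525, doi:10.1142/s0217984990000295, MetznerVollhardt1988, GebhardVollhardt1987, Sutherland1988, Tasaki1993, ParamekantiRanderiaTrivedi2001, ParamekantiRanderiaTrivedi2004, Gros1989, Edegge]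

Barriers (technique_class: cluster-expansion polymer-expansion determinantal-process): technique_class: cluster-expansion polymer-expansion determinantal-process variational-wavefunction
conditional-bridge
- Literature.Barriers.HubbardSuperconductivity.StrongCouplingCeiling: applies to cluster/polymer
expansions of e^{-βH} around t = 0 (βt < ε) and to deriving effective models with ground-state
control; NOT engaged — our expansion parameter is 1-g² (partial projection strength) for the
positive wavefunction measure |χ|² at T = 0, no Gibbs state of H is expanded and χ is never derived
from H (the link to H is the declared condition RVBShadowing).
- Literature.Barriers.HubbardSuperconductivity.SignProblemNPHard: evaded structurally for the
unconditional half — |χ|² ≥ 0 is a sign-free classical weight (what VMC samples); theorems about it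
need no sampling at all; numerics (kit enumerations) are calibration only.
- Literature.Barriers.HubbardSuperconductivity.GeneralizedHartreeFockNoPairing: Bach–Lieb–Solovej
kills pairing in quasi-free variational states with the bare repulsive interaction; χ is quasi-free
only at g = 1 and NO variational-energy statement about the Hubbard Hamiltonian is made anywhere in
the route (RVBShadowing compares correlators, not energies).
- Literature.Barriers.HubbardSuperconductivity.LROForcesLowLyingStates: consistent — χ is
number-projected (fixed N_L, S^z = 0), its order is ⟨Δ†Δ⟩-LRO with vanishing anomalous average,
exactly the summit's form; no uniqueness/gap claim is made.
- Literature.Barriers.HubbardSuperconductivity.PureModelStr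

History (route lifecycle, newest last):
- 2026-08-22T22:31:04Z · DORMANT — reconciler: no traction for 5.7 d (last activity item-evidence-added at 2026-08-17T04:40:47Z); parked, not closed — `ledger route dormant route-HubbardSupercond (operator:999:554989)

sub-problem: HubbardSuperconductivity · status: dormant · opened planner-plancard-HubbardSuperconductivity-Hub-8925b8cc-0 2026-08-15T10:53:55Z · rev 1 · ledger route-HubbardSuperconductivity-ProjectedBCSGas
GENERATED by the gate from the ledger (D-0016/17). Provers cite these decls: `theorem foo : Summit.HubbardSuperconductivity.HubbardSuperconductivity.Theses.ProjectedBCSGas.<Decl> := …` in Summits/HubbardSuperconductivity/HubbardSuperconductivity/Theorems/<Name>.lean.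
-/

namespace Summit.HubbardSuperconductivity.HubbardSuperconductivity.Theses.ProjectedBCSGas

open scoped BigOperators Topology Manifold Classical MeasureTheory ProbabilityTheory Matrix InnerProductSpace ComplexConjugate ContinuousMap
open Filter Set Function TopologicalSpace MeasureTheory

attribute [summit_statement] _root_.HubbardSuperconductivity
-- H21.Audit: conditional_on 'RVBShadowing' is not an accepted declaration — no route_premise tag

open Literature.Hubbard

/-- item stmt-HubbardSuperconductivity-1233 · crux · rank 2 · open · by planner
why it might fail: Universal over an unsimulated window: a 'projection transition' (pair coherence of |χ|² lost at some g<1, band-edge μ=±4 with atypical N_L, δ→1/2) or sign changes of G_χ at large distance along infinitely many L (nodal power-law tails) refute it; g=0 has no expansion (Φ>0 VMC-only, Φ→0 as δ→0).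
sources: ParamekantiRanderiaTrivedi2001, ParamekantiRanderiaTrivedi2004, EdeggerMuthukumarGros2007, Gros1989, MetznerVollhardt1988, GebhardVollhardt1987
[crux] Every (partially) Gutzwiller-projected, number-projected d-wave BCS state on the even torus —
χ[g,Δv,μ,δ] = normalise(P_g P_{N_L} Π_k (u_k + v_k c†_{k↑}c†_{-k↓})|0⟩), P_g = g^{#doublons} (g=0
Anderson/PRT RVB state, g=1 number-projected dBCS, 0<g<1 gossamer), N_L = 2⌊(1-δ)L²/2⌋ — has a
UNIFORM d-wave pair-coherence floor: pairFieldCorr_d(χ)_L(x,y) ≥ a(g,Δv,μ,δ) > 0 for all even L ≥ L₀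
and all ‖x-y‖_∞ ≥ R. 'RVB superconducts' as a clustering theorem for the positive measure |χ|²
(two-species determinantal gas tilted by g^{2D}). Expected a ≈ (g_t Δ)² ∝ δ² at g = 0 (RMFT/VMC).
Corners filed as supports: g = 1 (Wick + ensemble equivalence), g ∈ [g₀,1] (cluster expansion in
1-g²), μ → -∞ (doped NN-RVB loop gas). Sources: ParamekantiRanderiaTrivedi2001,
ParamekantiRanderiaTrivedi2004, Gros1989, EdeggerMuthukumarGros2007, MetznerVollhardt1988,
GebhardVollhardt1987, arXiv:cond-mat/0209269. -/
@[route_item "route-HubbardSuperconductivity-ProjectedBCSGas", crux]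
def ProjectedBCSPairLRO : Prop :=
  open Literature.MathematicalPhysics.QuantumLattice Literature.Probability.LatticeModels in ∀ g ∈ Set.Icc (0 : ℝ) 1, ∀ Δv ∈ Set.Ioc (0 : ℝ) 4, ∀ μ ∈ Set.Icc (-4 : ℝ) 4, ∀ δ ∈ Set.Ioo (0 : ℝ) (1 / 2), let χ : (L : ℕ) → Fock (Orb (FermionTorus 2 L)) := fun L => let N : ℕ := 2 * ⌊(1 - δ) * (L : ℝ) ^ 2 / 2⌋₊; let kc : FermionTorus 2 L → Fin 2 → ℝ := fun n i => Real.cos (2 * Real.pi * ((ofLex n i : ℕ) : ℝ) / L); let ξ : FermionTorus 2 L → ℝ := fun n => -2 * (kc n 0 + kc n 1) - μ; let Δ : FermionTorus 2 L → ℝ := fun n => Δv * (kc n 0 - kc n 1); let E : FermionTorus 2 L → ℝ := fun n => Real.sqrt (ξ n ^ 2 + Δ n ^ 2); let u : FermionTorus 2 L → ℝ := fun n => Real.sqrt ((1 + ξ n / E n) / 2); let v : FermionTorus 2 L → ℝ := fun n => (if 0 ≤ Δ n then 1 else -1) * Real.sqrt ((1 - ξ n / E n) / 2); let θ : FermionTorus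 2 L → FermionTorus 2 L → ℝ := fun n x => 2 * Real.pi * (((ofLex n 0 : ℕ) * (ofLex x 0 : ℕ) + (ofLex n 1 : ℕ) * (ofLex x 1 : ℕ) : ℕ) : ℝ) / L; let b : FermionTorus 2 L → Matrix (Finset (Orb (FermionTorus 2 L))) (Finset (Orb (FermionTorus 2 L))) ℂ := fun n => ∑ x : FermionTorus 2 L, ∑ y : FermionTorus 2 L, (Complex.exp (Complex.I * ((θ n x - θ n y : ℝ) : ℂ)) / (L : ℂ) ^ 2) • (creation (orb x 0) * creation (orb y 1)); let bcs : Fock (Orb (FermionTorus 2 L)) := ((Finset.univ : Finset (FermionTorus 2 L)).toList.map (fun n => ((u n : ℝ) : ℂ) • (1 : Matrix (Finset (Orb (FermionTorus 2 L))) (Finset (Orb (FermionTorus 2 L))) ℂ) + ((v n : ℝ) : ℂ) • b n)).prod *ᵥ vacuum; let raw : Fock (Orb (FermionTorus 2 L)) := fun s => (if s.card = N then (g : ℂ) ^ (Finset.univ.filter (fun x : FermionTorus 2 L => orb x 0 ∈ s ∧ orb x 1 ∈ s)).card else 0) * bcs s; (((Real.sqrt ((star raw ⬝ᵥ raw).re))⁻¹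 : ℝ) : ℂ) • raw; ∃ a > (0 : ℝ), ∃ R L₀ : ℕ, ∀ L : ℕ, Even L → L₀ ≤ L → ∀ x y : TorusSite 2 L, R ≤ torusDist x y → a ≤ pairFieldCorr dWaveFormFactor χ L x y

/-- item stmt-HubbardSuperconductivity-1234 · crux · rank 3 · open · by planner
why it might fail: No rigorous technology; false wherever pure t'=0 ground states are striped/non-SC (U=6-8, δ=1/8: QinEtAl2020; SC found only with t'≠0: XuEtAl2024); even if S holds, stripe/PDW-modulated or degeneracy-dependent G_ψ cannot be shadowed by ONE translation-invariant χ within a fixed η<1.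
sources: QinEtAl2020, XuEtAl2024, AndersonEtAl2004, ParamekantiRanderiaTrivedi2004, Anderson1987, ZhangEtAl1988
[crux — the CONDITION of this conditional bridge; no rigorous technology today] RVB shadowing of the
d-wave pair correlator: for some U > 0, δ ∈ (0,1/2), one member χ[g,Δv,μ,δ] of the family and some η
∈ [0,1): ∀ ε > 0 ∃ R, L₀ such that EVERY normalised (N_L, S^z=0)-sector ground state ψ_L of
hubbardTorus 2 L 1 U (even L ≥ L₀; hypotheses typed verbatim as in the summit statement) satisfies
|G_ψ(x,y) - G_χ(x,y)| ≤ η|G_χ(x,y)| + ε at all ‖x-y‖_∞ ≥ R, G = pairFieldCorr dWaveFormFactor. This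
is the precise content of 'the Gutzwiller-projected d-wave BCS state describes the superconducting
ground state' (plain-vanilla RVB), restricted to the one observable the assembly needs and with O(1)
relative slack η (covers the e^{-iS} dressing and the non-optimality of (Δv, μ)). Falsifiable
numerically (DMRG vs VMC pair correlators). Sources: AndersonEtAl2004,
ParamekantiRanderiaTrivedi2004, Anderson1987, QinEtAl2020. -/
@[route_item "route-HubbardSuperconductivity-ProjectedBCSGas", crux]
def RVBShadowing : Prop :=
  open Literature.MathematicalPhysics.QuantumLattice Literature.Probability.LatticeModels in ∃ U > (0 : ℝ), ∃ δ ∈ Set.Ioo (0 : ℝ) (1 / 2), ∃ g ∈ Set.Icc (0 : ℝ) 1, ∃ Δv ∈ Set.Ioc (0 : ℝ) 4, ∃ μ ∈ Set.Icc (-4 : ℝ) 4, ∃ η ∈ Set.Ico (0 : ℝ) 1, let χ : (L : ℕ) → Fock (Orb (FermionTorus 2 L)) := fun L => let N : ℕ := 2 * ⌊(1 - δ) * (L : ℝ) ^ 2 / 2⌋₊; let kc : FermionTorus 2 L → Fin 2 → ℝ := fun n i => Real.cos (2 * Real.pi * ((ofLex n i : ℕ) : ℝ) / L); let ξ : FermionTorus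 2 L → ℝ := fun n => -2 * (kc n 0 + kc n 1) - μ; let Δ : FermionTorus 2 L → ℝ := fun n => Δv * (kc n 0 - kc n 1); let E : FermionTorus 2 L → ℝ := fun n => Real.sqrt (ξ n ^ 2 + Δ n ^ 2); let u : FermionTorus 2 L → ℝ := fun n => Real.sqrt ((1 + ξ n / E n) / 2); let v : FermionTorus 2 L → ℝ := fun n => (if 0 ≤ Δ n then 1 else -1) * Real.sqrt ((1 - ξ n / E n) / 2); let θ : FermionTorus 2 L → FermionTorus 2 L → ℝ := fun n x => 2 * Real.pi * (((ofLex n 0 : ℕ) * (ofLex x 0 : ℕ) + (ofLex n 1 : ℕ) * (ofLex x 1 : ℕ) : ℕ) : ℝ) / L; let b : FermionTorus 2 L → Matrix (Finset (Orb (FermionTorus 2 L))) (Finset (Orb (FermionTorus 2 L))) ℂ := fun n => ∑ x : FermionTorus 2 L, ∑ y : FermionTorus 2 L, (Complex.exp (Complex.I * ((θ n x - θ n y : ℝ) : ℂ)) / (L : ℂ) ^ 2) • (creation (orb x 0) * creation (orb y 1)); let bcs : Fock (Orb (FermionTorus 2 L)) := ((Finset.univ : Finset (FermionTorus 2 L)).toList.map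 (fun n => ((u n : ℝ) : ℂ) • (1 : Matrix (Finset (Orb (FermionTorus 2 L))) (Finset (Orb (FermionTorus 2 L))) ℂ) + ((v n : ℝ) : ℂ) • b n)).prod *ᵥ vacuum; let raw : Fock (Orb (FermionTorus 2 L)) := fun s => (if s.card = N then (g : ℂ) ^ (Finset.univ.filter (fun x : FermionTorus 2 L => orb x 0 ∈ s ∧ orb x 1 ∈ s)).card else 0) * bcs s; (((Real.sqrt ((star raw ⬝ᵥ raw).re))⁻¹ : ℝ) : ℂ) • raw; ∀ ε > (0 : ℝ), ∃ R L₀ : ℕ, ∀ (N : ℕ → ℕ) (ψ : (L : ℕ) → Fock (Orb (FermionTorus 2 L))), (∀ L, Even L → N L = 2 * ⌊(1 - δ) * (L : ℝ) ^ 2 / 2⌋₊ ∧ star (ψ L) ⬝ᵥ ψ L = 1 ∧ IsGroundStateInSector (hubbardTorus 2 L 1 U) (N L) 0 (ψ L)) → ∀ L : ℕ, Even L → L₀ ≤ L → ∀ x y : TorusSite 2 L, R ≤ torusDist x y → |pairFieldCorr dWaveFormFactor ψ L x y - pairFieldCorr dWaveFormFactor χ L x y| ≤ η * |pairFieldCorr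 dWaveFormFactor χ L x y| + ε

/-- item stmt-HubbardSuperconductivity-1235 · support · rank 9 · open · by planner
why it might fail: Only the equivalence-of-ensembles step for number projection at a particle number atypical for (μ,Δv) (large-deviation regime of z ↦ Π_k(u_k²+v_k² z)) could hide a surprise; the Wick/Pfaffian part is exact.
sources: YangODLRO1962, BachLiebSolovej1994, doi:10.1103/physrevc.93.034313
[support — the g = 1 corner of ProjectedBCSPairLRO, provable now] The number-projected (unprojected,
g = 1) d-wave BCS state has a uniform d-wave pair-coherence floor. Mechanism: at g = 1 the
amplitudes are Pfaffian/determinantal (Wick), the pair correlator of the grand-canonical BCS state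
tends to |F_d|² with F_d = L⁻² Σ_k (cos k₁ - cos k₂) u_k v_k > 0 termwise (d-wave sign of v_k/u_k
matches the form factor), and number projection P_{N_L} is handled by equivalence of ensembles
(saddle point of z ↦ Π_k (u_k² + v_k² z), all factors positive) even when N_L is atypical for (μ,
Δv) (the projected state is again quasi-free-like with renormalised (u,v)). Why it might fail: only
through the ensemble-equivalence step at atypical N_L (large-deviation regime) — believed routine.
Sources: YangODLRO1962, BachLiebSolovej1994 (quasi-free states), doi:10.1103/physrevc.93.034313
(structure of number-projected BCS). -/
@[route_item "route-HubbardSuperconductivity-ProjectedBCSGas"]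
def UnprojectedBCSPairLRO : Prop :=
  open Literature.MathematicalPhysics.QuantumLattice Literature.Probability.LatticeModels in ∀ Δv ∈ Set.Ioc (0 : ℝ) 4, ∀ μ ∈ Set.Icc (-4 : ℝ) 4, ∀ δ ∈ Set.Ioo (0 : ℝ) (1 / 2), let g : ℝ := 1; let χ : (L : ℕ) → Fock (Orb (FermionTorus 2 L)) := fun L => let N : ℕ := 2 * ⌊(1 - δ) * (L : ℝ) ^ 2 / 2⌋₊; let kc : FermionTorus 2 L → Fin 2 → ℝ := fun n i => Real.cos (2 * Real.pi * ((ofLex n i : ℕ) : ℝ) / L); let ξ : FermionTorus 2 L → ℝ := fun n => -2 * (kc n 0 + kc n 1) - μ; let Δ : FermionTorus 2 L → ℝ := fun n => Δv * (kc n 0 - kc n 1); let E : FermionTorus 2 L → ℝ := fun n => Real.sqrt (ξ n ^ 2 + Δ n ^ 2); let u : FermionTorus 2 L → ℝ := fun n => Real.sqrt ((1 + ξ n / E n) / 2); let v : FermionTorus 2 L → ℝ := fun n => (if 0 ≤ Δ n then 1 else -1) * Real.sqrt ((1 - ξ n / E n) / 2); let θ : FermionTorus 2 L → FermionTorus 2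 L → ℝ := fun n x => 2 * Real.pi * (((ofLex n 0 : ℕ) * (ofLex x 0 : ℕ) + (ofLex n 1 : ℕ) * (ofLex x 1 : ℕ) : ℕ) : ℝ) / L; let b : FermionTorus 2 L → Matrix (Finset (Orb (FermionTorus 2 L))) (Finset (Orb (FermionTorus 2 L))) ℂ := fun n => ∑ x : FermionTorus 2 L, ∑ y : FermionTorus 2 L, (Complex.exp (Complex.I * ((θ n x - θ n y : ℝ) : ℂ)) / (L : ℂ) ^ 2) • (creation (orb x 0) * creation (orb y 1)); let bcs : Fock (Orb (FermionTorus 2 L)) := ((Finset.univ : Finset (FermionTorus 2 L)).toList.map (fun n => ((u n : ℝ) : ℂ) • (1 : Matrix (Finset (Orb (FermionTorus 2 L))) (Finset (Orb (FermionTorus 2 L))) ℂ) + ((v n : ℝ) : ℂ) • b n)).prod *ᵥ vacuum; let raw : Fock (Orb (FermionTorus 2 L)) := fun s => (if s.card = N then (g : ℂ) ^ (Finset.univ.filter (fun x : FermionTorus 2 L => orb x 0 ∈ s ∧ orb x 1 ∈ s)).card else 0) * bcs s; (((Real.sqrt ((star raw ⬝ᵥ raw).re))⁻¹ : ℝ)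 : ℂ) • raw; ∃ a > (0 : ℝ), ∃ R L₀ : ℕ, ∀ L : ℕ, Even L → L₀ ≤ L → ∀ x y : TorusSite 2 L, R ≤ torusDist x y → a ≤ pairFieldCorr dWaveFormFactor χ L x y

/-- item stmt-HubbardSuperconductivity-1236 · support · rank 9 · open · by planner
why it might fail: d-wave nodes ⇒ power-law kernels of the reference determinantal process along the diagonals; truncated correlations may not be summable, spoiling absolute convergence of the 1-g² Mayer series at every λ>0 (statement could still hold non-perturbatively).
sources: MetznerVollhardt1988, GebhardVollhardt1987, doi:10.1103/physrevb.47.4168, arXiv:cond-mat/0209269, doi:10.1103/physrevb.88.115127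
[support — the gossamer window of ProjectedBCSPairLRO] For every (Δv, μ, δ) in the window there is
g₀ < 1 such that the floor holds for all g ∈ [g₀, 1]: weak partial projection does not destroy
d-wave pair coherence. Mechanism: write |χ_g|² ∝ |χ_1|² Π_x (1 - λ D_x), λ = 1 - g², D_x the doublon
indicator; Mayer-expand the soft exclusion over the Wick-solvable g = 1 reference (a determinantal
process for each species) — the rigorous form of the Metzner–Vollhardt/Gebhard–Vollhardt (g²-1)
series; convergence for |λ| < λ₀ uniformly in L needs summable truncated correlations of the
reference process. Why it might fail: the d-wave nodes give power-law (not exponential) kernels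
along the diagonals, so absolute convergence may fail at every λ > 0 (then: nodeless d+id regulator
inside the proof, or a non-perturbative continuity argument). Sources: MetznerVollhardt1988,
GebhardVollhardt1987, doi:10.1103/physrevb.47.4168, arXiv:cond-mat/0209269. -/
@[route_item "route-HubbardSuperconductivity-ProjectedBCSGas"]
def GossamerWindowPairLRO : Prop :=
  open Literature.MathematicalPhysics.QuantumLattice Literature.Probability.LatticeModels in ∀ Δv ∈ Set.Ioc (0 : ℝ) 4, ∀ μ ∈ Set.Icc (-4 : ℝ) 4, ∀ δ ∈ Set.Ioo (0 : ℝ) (1 / 2), ∃ g₀ ∈ Set.Ico (0 : ℝ) 1, ∀ g ∈ Set.Icc g₀ 1, let χ : (L : ℕ) → Fock (Orb (FermionTorus 2 L)) := fun L => let N : ℕ := 2 * ⌊(1 - δ) * (L : ℝ) ^ 2 / 2⌋₊; let kc : FermionTorus 2 L → Fin 2 → ℝ := fun n i => Real.cos (2 * Real.pi * ((ofLex n i : ℕ) : ℝ) / L); let ξ : FermionTorus 2 L → ℝ := fun n => -2 * (kc n 0 + kc n 1) - μ; let Δ : FermionTorus 2 L → ℝ := fun n => Δv * (kc n 0 - kc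 n 1); let E : FermionTorus 2 L → ℝ := fun n => Real.sqrt (ξ n ^ 2 + Δ n ^ 2); let u : FermionTorus 2 L → ℝ := fun n => Real.sqrt ((1 + ξ n / E n) / 2); let v : FermionTorus 2 L → ℝ := fun n => (if 0 ≤ Δ n then 1 else -1) * Real.sqrt ((1 - ξ n / E n) / 2); let θ : FermionTorus 2 L → FermionTorus 2 L → ℝ := fun n x => 2 * Real.pi * (((ofLex n 0 : ℕ) * (ofLex x 0 : ℕ) + (ofLex n 1 : ℕ) * (ofLex x 1 : ℕ) : ℕ) : ℝ) / L; let b : FermionTorus 2 L → Matrix (Finset (Orb (FermionTorus 2 L))) (Finset (Orb (FermionTorus 2 L))) ℂ := fun n => ∑ x : FermionTorus 2 L, ∑ y : FermionTorus 2 L, (Complex.exp (Complex.I * ((θ n x - θ n y : ℝ) : ℂ)) / (L : ℂ) ^ 2) • (creation (orb x 0) * creation (orb y 1)); let bcs : Fock (Orb (FermionTorus 2 L)) := ((Finset.univ : Finset (FermionTorus 2 L)).toList.map (fun n => ((u n : ℝ) : ℂ) • (1 : Matrix (Finset (Orb (FermionTorus 2 L))) (Finset (Orb (FermionTorus 2 L)))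 ℂ) + ((v n : ℝ) : ℂ) • b n)).prod *ᵥ vacuum; let raw : Fock (Orb (FermionTorus 2 L)) := fun s => (if s.card = N then (g : ℂ) ^ (Finset.univ.filter (fun x : FermionTorus 2 L => orb x 0 ∈ s ∧ orb x 1 ∈ s)).card else 0) * bcs s; (((Real.sqrt ((star raw ⬝ᵥ raw).re))⁻¹ : ℝ) : ℂ) • raw; ∃ a > (0 : ℝ), ∃ R L₀ : ℕ, ∀ L : ℕ, Even L → L₀ ≤ L → ∀ x y : TorusSite 2 L, R ≤ torusDist x y → a ≤ pairFieldCorr dWaveFormFactor χ L x y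

/-- item stmt-HubbardSuperconductivity-1237 · support · rank 9 · open · by planner
why it might fail: Undoped square-lattice NN-RVB is critical (algebraic dimer correlations, AlbuquerqueAlet2010/TangSandvikHenley2011); control must come from monomer screening at δ>0, degrading as δ→0 (floor ∝ δ²); loop fugacities make the gas non-free-fermion.
sources: Anderson1987, Sutherland1988, RokhsarKivelson1988, doi:10.1142/s0217984990000295, AlbuquerqueAlet2010, TangSandvikHenley2011
[support — the μ → -∞ (short-range) rung: Anderson's doped nearest-neighbour RVB] χ^{RVB}_L =
normalise(P_G (Σ_{⟨xy⟩} s_d(x,y) c†_{x↑}c†_{y↓})^{N_L/2} |0⟩), s_d = +1 on e₁-bonds, -1 on e₂-bonds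
(singlet NN d-wave geminal power, fully projected; the μ → -∞ limit point of the family since φ̂_k →
Δ_k/2|μ| ∝ cos k₁ - cos k₂), has a uniform d-wave pair-coherence floor for every δ ∈ (0,1/2). Norms
and correlators are transition-graph LOOP-GAS sums with monomers (holes) and positive weights on the
bipartite even torus (Sutherland1988); target technology: cluster expansion in the
dimer/height-function language, chessboard/transfer-matrix estimates. Note the site-parity gauge
c_{yσ} ↦ (-1)^{y₂} c_{yσ} maps it to the extended-s NN-RVB and Δ_d to Δ_{s±}: the statement is
gauge-covariant, not trivial. Why it might fail: the undoped NN-RVB on the square lattice is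
CRITICAL (algebraic dimer correlations: AlbuquerqueAlet2010, TangSandvikHenley2011), so control must
come from monomer screening at δ > 0 and degrades as δ → 0 (floor expected ∝ δ²). Sources:
Anderson1987, Sutherland1988, RokhsarKivelson1988, doi:10.1142/s0217984990000295,
AlbuquerqueAlet2010, TangSandvikHenley2011. -/
@[route_item "route-HubbardSuperconductivity-ProjectedBCSGas"]
def DopedRVBPairLRO : Prop :=
  open Literature.MathematicalPhysics.QuantumLattice Literature.Probability.LatticeModels in ∀ δ ∈ Set.Ioo (0 : ℝ) (1 / 2), let χ : (L : ℕ) → Fock (Orb (FermionTorus 2 L)) := fun L => let N : ℕ := 2 * ⌊(1 - δ) * (L : ℝ) ^ 2 / 2⌋₊; let B : Matrix (Finset (Orb (FermionTorus 2 L))) (Finset (Orb (FermionTorus 2 L))) ℂ := ∑ x : FermionTorus 2 L, ∑ y : FermionTorus 2 L, (if (fermionTorusGraph 2 L).Adj x y then (if (ofLex x 1 : ℕ) = (ofLex y 1 : ℕ) then (1 : ℂ) else -1) else 0) • (creation (orb x 0) * creation (orb y 1)); let raw : Fock (Orb (FermionTorus 2 L)) := gutzwillerProj *ᵥ (B ^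 (N / 2) *ᵥ vacuum); (((Real.sqrt ((star raw ⬝ᵥ raw).re))⁻¹ : ℝ) : ℂ) • raw; ∃ a > (0 : ℝ), ∃ R L₀ : ℕ, ∀ L : ℕ, Even L → L₀ ≤ L → ∀ x y : TorusSite 2 L, R ≤ torusDist x y → a ≤ pairFieldCorr dWaveFormFactor χ L x y

/-- item stmt-HubbardSuperconductivity-1238 · assembly · rank 1 · closed · proved by Summit.HubbardSuperconductivity.HubbardSuperconductivity.Theorems.projectedBCSGas_assembly_proof (prover) · by planner
sources: Scalapino1995, YangODLRO1962
[assembly] RVBShadowing → ProjectedBCSPairLRO → HubbardSuperconductivity. Proof plan (routine): from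
RVBShadowing take U, δ, (g,Δv,μ), η; instantiate ProjectedBCSPairLRO there to get a, R₁, L₁; put ε
:= (1-η)a/2 and get R₂, L₂; for the summit's data (N, ψ) the hypothesis of RVBShadowing is verbatim
the summit's hypothesis, so for even L ≥ max L₁ L₂ and ‖x-y‖_∞ ≥ max R₁ R₂: G_ψ(x,y) ≥ G_χ - η|G_χ|
- ε = (1-η)G_χ - ε ≥ (1-η)a/2 > 0 (G_χ ≥ a > 0 there). Near pairs (‖x-y‖_∞ < R, at most L²(2R+1)² of
them) are bounded by |G_ψ(x,y)| ≤ ‖localPair_d‖² ≤ 32 (CAR: ‖c_i‖ ≤ 1). Hence (2k)⁻⁴ Σ_{x,y}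
G_ψ(2k;x,y) ≥ (1-η)a/2 · (1 - (2R+1)²/(2k)²) - 32(2R+1)²/(2k)² and the liminf over k is ≥ (1-η)a/2 >
0; rewrite the torus double sum as the halfOpenBox sum of torusPullback
(torusProj_bijOn_halfOpenBox) to land in HasLongRangeOrder (fun k => halfOpenBox 2 (2k)) (fun k =>
torusPullback (pairFieldCorr dWaveFormFactor ψ) (2k)) = the conclusion of
Literature.Hubbard.DWaveSuperconductivityHubbard. Sources: Scalapino1995, YangODLRO1962. -/
@[route_item "route-HubbardSuperconductivity-ProjectedBCSGas"]
def Assembly : Prop :=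
  RVBShadowing → ProjectedBCSPairLRO → HubbardSuperconductivity

/-! D-0027 §2.1 — DECIDING THEOREM (planner-authored via `route open/edit --closes-file`; by planner-rbadge-HubbardSuperconductivity-Projec-51c23b0e-g3-0 2026-08-16T05:14:38Z):
its hypotheses are this route's items and its conclusion the sub-problem Statement (glue_lint), and it elaborates with this file. -/

@[closes "route-HubbardSuperconductivity-ProjectedBCSGas"] theorem closes (h₁ : RVBShadowing) (h₂ : ProjectedBCSPairLRO) : _root_.HubbardSuperconductivity := by
  -- D-0027 §2.1. With ε := (1-η)a/2, far pairs (torusDist ≥ R) of every sector ground state carry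
  -- G_ψ ≥ b := (1-η)a/2 > 0; all pairs carry |G_ψ| ≤ C (pairFieldCorr_succ_le + Cauchy–Schwarz);
  -- a torus ball of radius < R has ≤ K := (2R+1)² sites; so Σ_{x,y} G_ψ ≥ bL⁴-(b+C)KL² ≥ (b/2)L⁴
  -- for large even L, and the summit's LRO sequence at L = 2k (= L⁻⁴ Σ G_ψ ≤ C) has liminf ≥ b/2.
  obtain ⟨U, hU, δ, hδ, g, hg, Δv, hΔv, μ, hμ, η, ⟨hη0, hη1⟩, hS⟩ := h₁
  obtain ⟨a, ha, R₁, L₁, hF⟩ := h₂ g hg Δv hΔv μ hμ δ hδ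
  have h1η : 0 < 1 - η := by linarith
  have hb : 0 < (1 - η) * a / 2 := by positivity
  obtain ⟨R₂, L₂, hS⟩ := hS ((1 - η) * a / 2) hb
  -- bookkeeping for an arbitrary torus two-point family G
  have bk : ∀ (G : (L : ℕ) → Literature.Probability.LatticeModels.TorusSite 2 L → Literature.Probability.LatticeModels.TorusSite 2 L → ℝ)
      (C K : ℝ) (R L₀ : ℕ), 0 ≤ C → 0 ≤ K →
      (∀ (L : ℕ) [NeZero L] (x : Literature.Probability.LatticeModels.TorusSite 2 L),
        ((Finset.univ.filter fun y : Literature.Probability.LatticeModels.TorusSite 2 L =>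
          Literature.MathematicalPhysics.QuantumLattice.torusDist x y < R).card : ℝ) ≤ K) →
      (∀ (L : ℕ) [NeZero L], Even L → L₀ ≤ L → ∀ x y : Literature.Probability.LatticeModels.TorusSite 2 L,
        |G L x y| ≤ C ∧ (R ≤ Literature.MathematicalPhysics.QuantumLattice.torusDist x y → (1 - η) * a / 2 ≤ G L x y)) →
      Literature.Probability.LatticeModels.HasLongRangeOrder (fun k => Literature.Probability.LatticeModels.halfOpenBox 2 (2 * k))
        (fun k => Literature.MathematicalPhysics.QuantumLattice.torusPullback G (2 * k)) := by
    intro G C K R L₀ hC0 hK0 hcount hG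
    have hcard : ∀ (L : ℕ) [NeZero L], (Finset.univ : Finset (Literature.Probability.LatticeModels.TorusSite 2 L)).card = L ^ 2 :=
      fun L _ => by
        simp only [Finset.card_univ, Fintype.card_pi, ZMod.card, Finset.prod_const, Fintype.card_fin]
    have total : ∀ (L : ℕ) [NeZero L], Even L → L₀ ≤ L →
        (1 - η) * a / 2 * (L : ℝ) ^ 4 - ((1 - η) * a / 2 + C) * K * (L : ℝ) ^ 2 ≤
          ∑ x, ∑ y, G L x y := by
      intro L _ hLe hL
      have row : ∀ x, (1 - η) * a / 2 * (L : ℝ) ^ 2 - ((1 - η) * a / 2 + C) * K ≤ ∑ y, G L x y := by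
        intro x
        have hpt : ∀ y : Literature.Probability.LatticeModels.TorusSite 2 L, (1 - η) * a / 2 - ((1 - η) * a / 2 + C) *
            (if Literature.MathematicalPhysics.QuantumLattice.torusDist x y < R then (1 : ℝ) else 0) ≤ G L x y := by
          intro y
          obtain ⟨h1, h2⟩ := hG L hLe hL x y
          split_ifs with h
          · have := (abs_le.1 h1).1
            linarith
          · have := h2 (not_lt.1 h)
            linarith
        calc (1 - η) * a / 2 * (L : ℝ) ^ 2 - ((1 - η) * a / 2 + C) * K
            ≤ (1 - η) * a / 2 * (L : ℝ) ^ 2 - ((1 - η) * a / 2 + C) *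
                ((Finset.univ.filter fun y : Literature.Probability.LatticeModels.TorusSite 2 L =>
                  Literature.MathematicalPhysics.QuantumLattice.torusDist x y < R).card : ℝ) := by
              have := hcount L x
              have hbC : 0 ≤ (1 - η) * a / 2 + C := by positivity
              nlinarith
          _ = ∑ y : Literature.Probability.LatticeModels.TorusSite 2 L, ((1 - η) * a / 2 - ((1 - η) * a / 2 + C) *
                (if Literature.MathematicalPhysics.QuantumLattice.torusDist x y < R then (1 : ℝ) else 0)) := by
              rw [Finset.sum_sub_distrib, Finset.sum_const, ← Finset.mul_sum, Finset.sum_boole, hcard]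
              ring
          _ ≤ _ := Finset.sum_le_sum fun y _ => hpt y
      calc (1 - η) * a / 2 * (L : ℝ) ^ 4 - ((1 - η) * a / 2 + C) * K * (L : ℝ) ^ 2
          = ∑ x : Literature.Probability.LatticeModels.TorusSite 2 L,
              ((1 - η) * a / 2 * (L : ℝ) ^ 2 - ((1 - η) * a / 2 + C) * K) := by
            rw [Finset.sum_const, hcard]
            ring
        _ ≤ _ := Finset.sum_le_sum fun x _ => row x
    -- the LRO sequence at side L ≠ 0 is L⁻⁴ Σ_{x,y} G L x y
    have key : ∀ (L : ℕ) [NeZero L],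
        (∑ x ∈ Literature.Probability.LatticeModels.halfOpenBox 2 L, ∑ y ∈ Literature.Probability.LatticeModels.halfOpenBox 2 L,
          Literature.MathematicalPhysics.QuantumLattice.torusPullback G L x y) /
            ((Literature.Probability.LatticeModels.halfOpenBox 2 L).card : ℝ) ^ 2 = (∑ x, ∑ y, G L x y) / (L : ℝ) ^ 4 := by
      intro L _
      rw [Literature.Probability.LatticeModels.card_halfOpenBox, Nat.cast_pow, ← pow_mul]
      congr 1
      simp only [Literature.MathematicalPhysics.QuantumLattice.torusPullback_apply]
      rw [Literature.MathematicalPhysics.QuantumLattice.sum_halfOpenBox_torusProj L (fun x =>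
        ∑ y ∈ Literature.Probability.LatticeModels.halfOpenBox 2 L, G L x (Literature.Probability.LatticeModels.Torus.proj L y))]
      exact Finset.sum_congr rfl fun x _ =>
        Literature.MathematicalPhysics.QuantumLattice.sum_halfOpenBox_torusProj L fun y => G L x y
    obtain ⟨L₃, hL₃⟩ := exists_nat_ge (2 * (((1 - η) * a / 2 + C) * K) / ((1 - η) * a / 2))
    refine lt_of_lt_of_le (half_pos hb) (le_liminf_of_le ?_ ?_)
    · -- eventual upper bound C (coboundedness of the real liminf)
      refine isCoboundedUnder_ge_of_eventually_le _ (x := C)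
        (eventually_atTop.2 ⟨max L₀ 1, fun k hk => ?_⟩)
      have hk0 : 2 * k ≠ 0 := by omega
      haveI : NeZero (2 * k) := ⟨hk0⟩
      have hpos : (0 : ℝ) < ((2 * k : ℕ) : ℝ) ^ 4 := by positivity
      dsimp only
      rw [key (2 * k), div_le_iff₀ hpos]
      have h := Finset.sum_le_sum fun x (_ : x ∈ Finset.univ) =>
        Finset.sum_le_sum fun y (_ : y ∈ Finset.univ) =>
          (abs_le.1 (hG (2 * k) (even_two_mul k) (by omega) x y).1).2
      refine h.trans (le_of_eq ?_)
      simp only [Finset.sum_const, hcard, nsmul_eq_mul]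
      push_cast
      ring
    · -- eventual lower bound b/2
      refine eventually_atTop.2 ⟨max (max L₀ L₃) 1, fun k hk => ?_⟩
      have hk0 : 2 * k ≠ 0 := by omega
      haveI : NeZero (2 * k) := ⟨hk0⟩
      have hpos : (0 : ℝ) < ((2 * k : ℕ) : ℝ) ^ 4 := by positivity
      dsimp only
      rw [key (2 * k), le_div_iff₀ hpos]
      have ht := total (2 * k) (even_two_mul k) (by omega)
      have hM1 : (1 : ℝ) ≤ ((2 * k : ℕ) : ℝ) := by exact_mod_cast (by omega : 1 ≤ 2 * k)
      have hM3 : (L₃ : ℝ) ≤ ((2 * k : ℕ) : ℝ) := by exact_mod_cast (by omega : L₃ ≤ 2 * k)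
      have h1 : ((1 - η) * a / 2 + C) * K ≤ (1 - η) * a / 2 / 2 * ((2 * k : ℕ) : ℝ) := by
        have := (div_le_iff₀ hb).1 (hL₃.trans hM3)
        linarith
      have h3 : ((2 * k : ℕ) : ℝ) ^ 3 ≤ ((2 * k : ℕ) : ℝ) ^ 4 := pow_le_pow_right₀ hM1 (by norm_num)
      nlinarith [mul_le_mul_of_nonneg_right h1 (sq_nonneg (((2 * k : ℕ) : ℝ))),
        mul_le_mul_of_nonneg_left h3 hb.le]
  -- apply it to G_ψ: a priori bound C (normalisation + ‖P_x ψ‖ ≤ C_d) and the far-pair floor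
  refine ⟨U, hU, δ, hδ, fun N ψ hyp => bk _ _ ((2 * max R₁ R₂ + 1) ^ 2 : ℕ) (max R₁ R₂) (max L₁ L₂)
    (sq_nonneg (∑ e ∈ insert 0 Literature.MathematicalPhysics.QuantumLattice.unitSteps,
      ‖((Literature.MathematicalPhysics.QuantumLattice.dWaveFormFactor e / Real.sqrt 2 : ℝ) : ℂ)‖ * 2)) (by positivity)
    (fun L _ x => ?_) (fun L _ hLe hL x y => ⟨abs_le.2 ⟨?_, ?_⟩, fun hxy => ?_⟩)⟩
  · -- torus ball count ≤ (2R+1)²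
    have hnat : (Finset.univ.filter fun y : Literature.Probability.LatticeModels.TorusSite 2 L =>
        Literature.MathematicalPhysics.QuantumLattice.torusDist x y < max R₁ R₂).card ≤ (2 * max R₁ R₂ + 1) ^ 2 := by
      calc (Finset.univ.filter fun y : Literature.Probability.LatticeModels.TorusSite 2 L =>
            Literature.MathematicalPhysics.QuantumLattice.torusDist x y < max R₁ R₂).card
          ≤ (Fintype.piFinset fun _ : Fin 2 =>
              Finset.range (max R₁ R₂ + 1) ∪ Finset.Ico (L - max R₁ R₂) L).card := by
            refine Finset.card_le_card_of_injOn (fun y i => ((x - y) i).val) ?_ ?_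
            · intro y hy
              simp only [Finset.coe_filter, Finset.mem_univ, true_and, Set.mem_setOf_eq] at hy
              simp only [Finset.mem_coe, Fintype.mem_piFinset, Finset.mem_union, Finset.mem_range,
                Finset.mem_Ico]
              intro i
              have hi : min ((x - y) i).val (L - ((x - y) i).val) ≤ max R₁ R₂ := by
                have := (Finset.sup_le_iff.1
                  (show Literature.MathematicalPhysics.QuantumLattice.torusNorm (x - y) ≤ max R₁ R₂ from hy.le)) i (Finset.mem_univ i)
                simpa using this
              have hlt : ((x - y) i).val < L := ZMod.val_lt _
              rcases min_le_iff.1 hi with h | h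
              · left; omega
              · right; omega
            · intro y₁ _ y₂ _ h
              have key : x - y₁ = x - y₂ := funext fun i => ZMod.val_injective L (congrFun h i)
              exact sub_right_injective key
        _ = (Finset.range (max R₁ R₂ + 1) ∪ Finset.Ico (L - max R₁ R₂) L).card ^ 2 := by
            rw [Fintype.card_piFinset_const]
        _ ≤ (2 * max R₁ R₂ + 1) ^ 2 := by
            gcongr
            refine (Finset.card_union_le _ _).trans ?_
            simp only [Finset.card_range, Nat.card_Ico]
            omega
    exact_mod_cast hnat
  · -- lower a priori bound: -C ≤ G_ψ (Cauchy–Schwarz)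
    obtain ⟨n, rfl⟩ : ∃ n, L = n + 1 := ⟨L - 1, by have := NeZero.ne L; omega⟩
    obtain ⟨-, hψ, -⟩ := hyp (n + 1) hLe
    have h := Literature.MathematicalPhysics.QuantumLattice.norm_toLp_sq_eq_re (ψ (n + 1))
    rw [hψ, Complex.one_re] at h
    have h1 := (pow_eq_one_iff_of_nonneg (norm_nonneg _) two_ne_zero).1 h
    have hx := Literature.MathematicalPhysics.QuantumLattice.norm_toLp_localPair_mulVec_le Literature.MathematicalPhysics.QuantumLattice.dWaveFormFactor (n + 1) x (ψ (n + 1))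
    have hy := Literature.MathematicalPhysics.QuantumLattice.norm_toLp_localPair_mulVec_le Literature.MathematicalPhysics.QuantumLattice.dWaveFormFactor (n + 1) y (ψ (n + 1))
    rw [h1, mul_one] at hx hy
    rw [Literature.MathematicalPhysics.QuantumLattice.pairFieldCorr_succ, Literature.MathematicalPhysics.QuantumLattice.PosSemidefTrace.expect_conjTranspose_mul, neg_le,
      ← Complex.neg_re, ← neg_dotProduct, ← star_neg]
    refine (Literature.MathematicalPhysics.QuantumLattice.re_star_dotProduct_le_norm_mul_norm _ _).trans ?_
    rw [WithLp.toLp_neg, norm_neg, sq]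
    exact mul_le_mul hx hy (norm_nonneg _) (Literature.MathematicalPhysics.QuantumLattice.localPairNormBound_nonneg _)
  · -- upper a priori bound: G_ψ ≤ C
    obtain ⟨n, rfl⟩ : ∃ n, L = n + 1 := ⟨L - 1, by have := NeZero.ne L; omega⟩
    exact Literature.MathematicalPhysics.QuantumLattice.pairFieldCorr_succ_le _ ψ n (hyp (n + 1) hLe).2.1 x y
  · -- far pairs: shadowing + floor
    have hf := hF L hLe ((le_max_left _ _).trans hL) x y ((le_max_left _ _).trans hxy)
    have hs := hS N ψ hyp L hLe ((le_max_right _ _).trans hL) x y ((le_max_right _ _).trans hxy)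
    rw [abs_of_pos (ha.trans_le hf)] at hs
    have hs' := (abs_sub_le_iff.1 hs).2
    have hm := mul_le_mul_of_nonneg_left hf h1η.le
    linarith

end Summit.HubbardSuperconductivity.HubbardSuperconductivity.Theses.ProjectedBCSGas
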